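import Summits.Langlands.Langlands.Theses.DisagreementBeurling
import HarnessLib

/-!
# `DisagreementBeurling.HessianGlue36` (stmt-Langlands-14439) — the body of `closes`, proved

[proof of `Summit.Langlands.Langlands.Theses.DisagreementBeurling.HessianGlue36`
(route `DisagreementBeurling`, support item, rank 9): `InteriorRigidity → LandauLineNeverCentral →
ThinPairDichotomy → CanonicalDescent36 → DefectTable36 → StrongArtinHessian36`]

Pure logic — the eight lines of the route's deciding theorem `closes` with the sector junction
`SectorComplement : StrongArtinHessian36 → Langlands` removed, so that an ITEM of the route concludes
the route's thesis `StrongArtinHessian36` by name.  For an irreducible even `σ : Γ_ℚ → GL₂(ℂ)` with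
projective image the Hessian group of order 216 and 2-Sylow `Q₈`: `CanonicalDescent36` gives the pinned
Maass pair datum `P` at `q = 3`; `DefectTable36` certifies the defect table; `ThinPairDichotomy` then
yields either the automorphic realisation (done) or a Landau-line witness `(T, α, β, b)` with
`1 ≤ b`, which `LandauLineNeverCentral` (`b = 1`) resp. `InteriorRigidity` (`1 < b`) forbids.
No Literature named fact is consumed; axioms `propext`, `Classical.choice`, `Quot.sound`. -/

set_option linter.dupNamespace false

namespace Summit.Langlands.Langlands.Theorems.DisagreementBeurlingHessianGlue36

open Summit.Langlands.Langlands.Theses.DisagreementBeurling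

/-- **stmt-Langlands-14439** `DisagreementBeurling.HessianGlue36`: the five cruxes/supports of the
route imply its thesis `StrongArtinHessian36` (the body of `closes` without the sector junction). -/
theorem hessianGlue36 : HessianGlue36 := by
  intro h₁ h₂ h₃ h₄ h₅ F _ _ ρ hirr htype
  obtain ⟨hcpt, P, hinf, hpat⟩ := h₄ F ρ hirr htype
  refine ⟨hcpt, P, ?_⟩
  rcases h₃ F 3 (by norm_num) hcpt P ρ hirr hinf (h₅ F ρ hirr htype hcpt P hpat) with
    h | ⟨T, α, β, b, hb1, hb2, hP⟩
  · exact h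
  · exfalso
    rcases hb1.eq_or_lt with h12 | h12
    · exact h₂ F 3 T α β b h12.symm hP
    · exact h₁ F 3 T α β b h12 hb2 hP

end Summit.Langlands.Langlands.Theorems.DisagreementBeurlingHessianGlue36
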